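import Literature.Topology.FourManifolds.TrisectionStabilizationConnectSumPi1
import Literature.Topology.FourManifolds.TrisectionStabilizationDatumSphere
import HarnessLib

/-!
# (d′) from ONE IMPLANT in joint-chart datum form: the unbalanced assembly

Topic `Literature/Topology/FourManifolds`; fact seat
`provefact-Literature.Topology.FourManifolds.sphere-99d675ea90` (named fact (d′)
`Literature.Topology.FourManifolds.sphere_gkTrisections`).  Everything in this file is **proved**;
there are no definitions and no named facts.

`TrisectionStabilizationDatumAssembly.lean` reduces (d′) to ONE balanced geometric stabilisation
step (genus `g ↦ g + 3`) in joint-chart datum form.  The tree's geometric stabilisation is made of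
three implants (`TriNormalForm.exists_stabilization`, `TrisectionsStabilizationNF.lean`; Gay–Kirby
prove Lemma 10 "one eye at a time"), and `GroupTrisectionsConnectSum.lean` /
`TrisectionStabilizationConnectSumPi1.lean` supply the matching algebra and `π₁` stage
(`TrisectionKernels.stabilizeOne`, `stabilize_eq_stabilizeOne`,
`exists_marking_groupGKTrisectionOf_eq_stabilizeOne_datum`,
`sphere_gkTrisections_of_invariant_stabilizeOne_step`).  This file spells out the resulting
reduction of (d′) to ONE IMPLANT: `sphere_gkTrisections_of_jointChartDatum_stabilizeOne_step` —
**(d′) holds as soon as, for each sector `i`, every marked `(g; k)`-trisection of the round `S⁴`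
carrying a joint-chart datum admits a marked `(g + 1; k + [· = i])`-trisection carrying a
joint-chart datum whose kernel triple is `𝒢.stabilizeOne i` ON THE NOSE.**  The joint-chart
datum `JCD` is the one of the balanced assembly (a joint chart `Θ` — all three sectors linear in
the normal plane, Gay–Kirby's Fig. 1 / the tree's `TriNormalForm` wedges —, the cell
`Φ(z) = Θ⁻¹(0, 0, ρ z)` on `B̄(0, 2)`, and a free basis `θ_A` of `π₁(F ∖ Φ(B(0,1)), x₀)`,
`x₀ = Φ(1, 0)`, with `θ_A(r_g) = [∂]` and `μ ∘ mk = (A ⊆ F)_* ∘ θ_A`); the base is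
`GayKirby.sphereSector_exists_jointChart_datum`.

## References

* D. Gay, R. Kirby, *Trisecting 4-manifolds*, Geom. Topol. 20 (2016) 3097–3132
  (arXiv:1205.1565): §2 (arXiv p. 5: the trisections of `S⁴`), Def. 8, Lemma 10 and its proof
  (arXiv pp. 31–32: one eye at a time). [GayKirby2016]
* A. Abrams, D. Gay, R. Kirby, *Group trisections and smooth 4-manifolds*, Geom. Topol. 22
  (2018) 1537–1545: Def. 2–3, Thm. 5 (p. 1541). [AbramsGayKirby2018]
-/

noncomputable section

open Set Metric Function
open Literature.AlgebraicTopology.FundamentalGroup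
open Literature.AlgebraicTopology.FundamentalGroup.VanKampen
open scoped Manifold ContDiff

namespace Literature.Topology.FourManifolds

/-- **(d′) from one implant in joint-chart datum form.**  With `JCD(g, S, x₀, μ)` the joint-chart
datum of `sphere_gkTrisections_of_jointChartDatum_step` (spelled out below, twice): if for each
sector `i` every marked Gay–Kirby `(g; k)`-trisection of the round `S⁴` with `JCD` admits a marked
`(g + 1; k + [· = i])`-trisection with `JCD` whose kernel triple is `(𝒢(h, x₀, μ)).stabilizeOne i`
on the nose (one implant = Gay–Kirby's unbalanced stabilisation inside the chart box, proof of
Lemma 10; its `π₁` stage is `exists_marking_groupGKTrisectionOf_eq_stabilizeOne_datum`, its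
old-handlebody inputs are `IsGKTrisection.surjective_inclHomOfSubset_diff_image_ball_bite` and the
bite lemmas of `TrisectionStabilizationBite.lean`), then (d′) `sphere_gkTrisections` holds
(`sphere_gkTrisections_of_invariant_stabilizeOne_step` with the base
`GayKirby.sphereSector_exists_jointChart_datum`). [cite: GayKirby2016, §2 (arXiv p. 5), Lemma 10 and its proof (arXiv pp. 31–32)]
[cite: AbramsGayKirby2018, Def. 3 (p. 1540) and Thm. 5 (p. 1541)] -/
theorem sphere_gkTrisections_of_jointChartDatum_stabilizeOne_step
    (step : ∀ (i : Fin 3) (g : ℕ) (k : Fin 3 → ℕ)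
      (S : Fin 3 → Set (Metric.sphere (0 : EuclideanSpace ℝ (Fin 5)) 1))
      (h : IsGKTrisection (Metric.sphere (0 : EuclideanSpace ℝ (Fin 5)) 1) g k S)
      (x₀ : centralSurface S)
      (μ : SurfaceGroup g ≃* _root_.FundamentalGroup (centralSurface S) x₀),
      (∃ (Θ : OpenPartialHomeomorph (Metric.sphere (0 : EuclideanSpace ℝ (Fin 5)) 1)
          (EuclideanSpace ℝ (Fin 4))) (i j l : Fin 3) (ρ : ℝ)
        (Φ : C(closedBall (0 : EuclideanSpace ℝ (Fin 2)) 2, Metric.sphere (0 : EuclideanSpace ℝ (Fin 5)) 1))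
        (O : Set (Metric.sphere (0 : EuclideanSpace ℝ (Fin 5)) 1)),
        Θ ∈ IsManifold.maximalAtlas (𝓡 4) ∞ (Metric.sphere (0 : EuclideanSpace ℝ (Fin 5)) 1) ∧
        j ≠ i ∧ l ≠ i ∧ l ≠ j ∧
        (∀ y ∈ Θ.source, y ∈ S i ↔ (0 ≤ Θ y 0 ∧ 0 ≤ Θ y 1)) ∧
        (∀ y ∈ Θ.source, y ∈ (⋂ m, S m) ↔ (Θ y 0 = 0 ∧ Θ y 1 = 0)) ∧
        (∀ y ∈ Θ.source, y ∈ S j ↔ (Θ y 0 ≤ 0 ∧ Θ y 0 ≤ Θ y 1)) ∧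
        (∀ y ∈ Θ.source, y ∈ S l ↔ (Θ y 1 ≤ 0 ∧ Θ y 1 ≤ Θ y 0)) ∧
        0 < ρ ∧ (∀ z, Φ z ∈ Θ.source) ∧
        (∀ z, Θ (Φ z) =
          !₂[0, 0, ρ * (z : EuclideanSpace ℝ (Fin 2)) 0, ρ * (z : EuclideanSpace ℝ (Fin 2)) 1]) ∧
        Injective Φ ∧ range Φ ⊆ (⋂ m, S m) ∧ IsOpen O ∧ O ⊆ Θ.source ∧
        O = {y | y ∈ Θ.source ∧ ‖(!₂[Θ y 2, Θ y 3] : EuclideanSpace ℝ (Fin 2))‖ < 2 * ρ} ∧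
        (⋂ m, S m) ∩ O = Φ '' {z | ‖(z : EuclideanSpace ℝ (Fin 2))‖ < 2} ∧
        (x₀ : Metric.sphere (0 : EuclideanSpace ℝ (Fin 5)) 1) =
          Φ ⟨Complex.orthonormalBasisOneI.repr 1, closedBall_subset_closedBall one_le_two (by simp)⟩ ∧
        IsPathConnected ((⋂ m, S m) \ Φ '' {z | ‖(z : EuclideanSpace ℝ (Fin 2))‖ < 1}) ∧
        ∃ (hx₀C : (x₀ : Metric.sphere (0 : EuclideanSpace ℝ (Fin 5)) 1) ∈
              Φ '' {z | ‖(z : EuclideanSpace ℝ (Fin 2))‖ = 1})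
          (hCA : Φ '' {z | ‖(z : EuclideanSpace ℝ (Fin 2))‖ = 1} ⊆
            (⋂ m, S m) \ Φ '' {z | ‖(z : EuclideanSpace ℝ (Fin 2))‖ < 1})
          (hAF : (⋂ m, S m) \ Φ '' {z | ‖(z : EuclideanSpace ℝ (Fin 2))‖ < 1} ⊆ ⋂ m, S m)
          (t : _root_.FundamentalGroup ↥(Φ '' {z | ‖(z : EuclideanSpace ℝ (Fin 2))‖ = 1}) ⟨_, hx₀C⟩)
          (θA : FreeGroup (surfaceGen g) ≃*
            _root_.FundamentalGroup ↥((⋂ m, S m) \ Φ '' {z | ‖(z : EuclideanSpace ℝ (Fin 2))‖ < 1})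
              ⟨_, hCA hx₀C⟩),
          Subgroup.closure {t} = ⊤ ∧
          θA (surfaceRelator g) = inclHomOfSubset hCA _ hx₀C (hCA hx₀C) t ∧
          μ.toMonoidHom.comp (PresentedGroup.mk _) =
            (inclHomOfSubset hAF _ (hCA hx₀C) (hAF (hCA hx₀C))).comp θA.toMonoidHom) →
      ∃ (S' : Fin 3 → Set (Metric.sphere (0 : EuclideanSpace ℝ (Fin 5)) 1))
        (h' : IsGKTrisection (Metric.sphere (0 : EuclideanSpace ℝ (Fin 5)) 1) (g + 1)
          (Function.update k i (k i + 1)) S')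
        (x₀' : centralSurface S')
        (μ' : SurfaceGroup (g + 1) ≃* _root_.FundamentalGroup (centralSurface S') x₀'),
        (∃ (Θ : OpenPartialHomeomorph (Metric.sphere (0 : EuclideanSpace ℝ (Fin 5)) 1)
            (EuclideanSpace ℝ (Fin 4))) (i j l : Fin 3) (ρ : ℝ)
          (Φ : C(closedBall (0 : EuclideanSpace ℝ (Fin 2)) 2, Metric.sphere (0 : EuclideanSpace ℝ (Fin 5)) 1))
          (O : Set (Metric.sphere (0 : EuclideanSpace ℝ (Fin 5)) 1)),
          Θ ∈ IsManifold.maximalAtlas (𝓡 4) ∞ (Metric.sphere (0 : EuclideanSpace ℝ (Fin 5)) 1) ∧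
          j ≠ i ∧ l ≠ i ∧ l ≠ j ∧
          (∀ y ∈ Θ.source, y ∈ S' i ↔ (0 ≤ Θ y 0 ∧ 0 ≤ Θ y 1)) ∧
          (∀ y ∈ Θ.source, y ∈ (⋂ m, S' m) ↔ (Θ y 0 = 0 ∧ Θ y 1 = 0)) ∧
          (∀ y ∈ Θ.source, y ∈ S' j ↔ (Θ y 0 ≤ 0 ∧ Θ y 0 ≤ Θ y 1)) ∧
          (∀ y ∈ Θ.source, y ∈ S' l ↔ (Θ y 1 ≤ 0 ∧ Θ y 1 ≤ Θ y 0)) ∧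
          0 < ρ ∧ (∀ z, Φ z ∈ Θ.source) ∧
          (∀ z, Θ (Φ z) =
            !₂[0, 0, ρ * (z : EuclideanSpace ℝ (Fin 2)) 0, ρ * (z : EuclideanSpace ℝ (Fin 2)) 1]) ∧
          Injective Φ ∧ range Φ ⊆ (⋂ m, S' m) ∧ IsOpen O ∧ O ⊆ Θ.source ∧
          O = {y | y ∈ Θ.source ∧ ‖(!₂[Θ y 2, Θ y 3] : EuclideanSpace ℝ (Fin 2))‖ < 2 * ρ} ∧
          (⋂ m, S' m) ∩ O = Φ '' {z | ‖(z : EuclideanSpace ℝ (Fin 2))‖ < 2} ∧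
          (x₀' : Metric.sphere (0 : EuclideanSpace ℝ (Fin 5)) 1) =
            Φ ⟨Complex.orthonormalBasisOneI.repr 1, closedBall_subset_closedBall one_le_two (by simp)⟩ ∧
          IsPathConnected ((⋂ m, S' m) \ Φ '' {z | ‖(z : EuclideanSpace ℝ (Fin 2))‖ < 1}) ∧
          ∃ (hx₀C : (x₀' : Metric.sphere (0 : EuclideanSpace ℝ (Fin 5)) 1) ∈
                Φ '' {z | ‖(z : EuclideanSpace ℝ (Fin 2))‖ = 1})
            (hCA : Φ '' {z | ‖(z : EuclideanSpace ℝ (Fin 2))‖ = 1} ⊆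
              (⋂ m, S' m) \ Φ '' {z | ‖(z : EuclideanSpace ℝ (Fin 2))‖ < 1})
            (hAF : (⋂ m, S' m) \ Φ '' {z | ‖(z : EuclideanSpace ℝ (Fin 2))‖ < 1} ⊆ ⋂ m, S' m)
            (t : _root_.FundamentalGroup ↥(Φ '' {z | ‖(z : EuclideanSpace ℝ (Fin 2))‖ = 1}) ⟨_, hx₀C⟩)
            (θA : FreeGroup (surfaceGen (g + 1)) ≃*
              _root_.FundamentalGroup ↥((⋂ m, S' m) \ Φ '' {z | ‖(z : EuclideanSpace ℝ (Fin 2))‖ < 1})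
                ⟨_, hCA hx₀C⟩),
            Subgroup.closure {t} = ⊤ ∧
            θA (surfaceRelator (g + 1)) = inclHomOfSubset hCA _ hx₀C (hCA hx₀C) t ∧
            μ'.toMonoidHom.comp (PresentedGroup.mk _) =
              (inclHomOfSubset hAF _ (hCA hx₀C) (hAF (hCA hx₀C))).comp θA.toMonoidHom) ∧
        groupGKTrisectionOf h' x₀' μ' = (groupGKTrisectionOf h x₀ μ).stabilizeOne i) :
    sphere_gkTrisections := by
  refine sphere_gkTrisections_of_invariant_stabilizeOne_step _ ?_ step
  -- the base: Gay–Kirby's genus-`0` trisection of `S⁴` with the joint-chart datum at `e₂`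
  have h₀ : IsBalancedGKTrisection (Metric.sphere (0 : EuclideanSpace ℝ (Fin 5)) 1) 0 0
      GayKirby.sphereSector := sphereSector_isBalancedGKTrisection_holds
  obtain ⟨Θ, l, ρ, Φ, O, ⟨hΘ, -, -, hli, hlj, hSi, hF, hSj, hSl, hρ, h1, h2, -, hinj, hΦF, hO,
    h7, -, h9, hFO⟩, hx₀, hA, hCA, hCAe, hCCA, hsdr, hAsc, hApc, hCpc, hAF, t, θA, μ₀, ht, hθA, hμ⟩ :=
    GayKirby.sphereSector_exists_jointChart_datum (i := 0) (j := 1) (by decide)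
      GayKirby.sphereSector_basePoint.2
  exact ⟨GayKirby.sphereSector, h₀, ⟨_, hAF (hCA hx₀)⟩, μ₀, Θ, 0, 1, l, ρ, Φ, O, hΘ, by decide,
    hli, hlj, hSi, hF, hSj, hSl, hρ, h1, h2, hinj, hΦF, hO, h7, h9, hFO, rfl, hApc, hx₀, hCA, hAF,
    t, θA, ht, hθA, hμ⟩

end Literature.Topology.FourManifolds
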